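import Summits.QuantumFields.BalabanUV.Beta.D1BFx.SymBmAbsorbsBm
import Summits.QuantumFields.BalabanUV.Beta.SymmetrisedDressingLinear
import Summits.QuantumFields.BalabanUV.Beta.AxialDressingRootedBmHessian
import Summits.QuantumFields.BalabanUV.Beta.CombChartJointEnd

/-!
# `BalabanUV.Beta.D1BFx.CombVertexAbsorption` — road «BF-x», binder row D1, slot (K), junction (J1) after «(J1-γ) ABSORPTION» (an2 R-D1-g42-3): **«COMB-VERTEX-ABSORPTION»
# — THE ROAD's PACKED FIRST-ORDER VERTEX AT THE DRESSED (III′) LITERAL IS THE LEG-DRESSED COMB-CHART VERTEX OF THE RAW TABLES**: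
# `vertexOfK (G₀^{bm} r) n (dressSymAt ρc (dressAt ρc J⁰)).S μ y = dressKSymAt ρc n (dressKAt ρc n (vertexOfK (GcombSh n 0) n J⁰.S μ y))` for EVERY in-block road root `r`
# and EVERY raw datum `J⁰` — the literal's two SLOT dressings move onto the packing column (an2's windowed adjunctions), where d1-p2's absorption
# `Π̂^{sym}_{ρc} Π^{ρ}_bm = Π̂^{sym}_{ρc}` turns `colH (G₀^{bm} r)` into `colH (GcombSh n 0)`; the two LEG dressings ride along (an2's `vertexOfK_dressK(Sym)At`) to be absorbed
# into the legs of each trace word (an2 R-D1-g42-4 W-20 (c2)).  The per-slot n-powers of the dressed tables (d1-formalise-leaf-03 W-2 (b); this lineage's ONLINE ∕ W-2 count,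
# gen 56: `∼ n³` at spine slots) NEVER ENTER: the RAW tables' letters and the new weights' envelope «GCOMB-COL-ENV» (`D1BFx/CombColumnEnvelope`: `n⁻⁴`, one power
# for both gauges) do — an2's caveat (c1) «the packing weights `colH G₀^{bm}` need their own absorption∕blindness letter» ANSWERED at first order.

HONEST DEPENDENCY (cell records, verbatim): «continuum YM on T⁴ ⇐ BetaPertH ∧ nine spine estimates (0/9 proved); BetaPertH ⇐ (D1) ∧ (D4) ∧
CAP+tail; G-an2-4 gates asym, D1 and NE2/3/4.»  HONEST FRAMING (cell contract, verbatim): «discharging `BetaPertH` makes Bałaban's UV stability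
UNCONDITIONAL — a real constructive-QFT result; it is NOT the continuum limit and NOT the Clay problem.»  THIS MODULE DISCHARGES NOTHING of the
wall: [folklore] composition BY NAME of LANDED identities — an2's windowed adjunctions `AxialDressingRootedHessian.vertexOfK_coProjAtK` ∕
`SymmetrisedDressingLinear.vertexOfK_coProjSymAtK` with `colH_coDressKAt_eq` ∕ `colH_coDressKSymAt_eq`, his slot∕leg letters `locStencil_coProjAtK` ∕ `locStencil_coProjSymAtK` ∕
`locStencil_dressKAt`, `vertexOfK_dressKAt` ∕ `vertexOfK_dressKSymAt`, `dressKAt_finset_sum` ∕ `dressKAt_mul_left`, `decays_coDressKSymAt` ∕ `decays_coDressKBmAt_KInvStep`,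
`GcombSh_apply` ∕ `Gsym_apply`, and the OWNER d1-p2 g21's absorption `SymBmAbsorbsBm.coDressKSymAt_coDressKBmAt` (ANY two in-block roots).  (The single-dressing pack-bridges
are d1-formalise-leaf-03's `PackedDressingBridgeComb.vertexOfK_coDressKAt_eq` ∕ `vertexOfK_coDressKSymAt_eq`; §1 here is their COMPOSITE, derived from an2's primitives so that no
statement is duplicated.)  No definition, no `def … : Prop`, nothing cited, 0 sorry.  NO (1.22) row; (J1-W) tadpole row OPEN; the CURRENCY of the road's (L1)(L2) letters (S7) is the
row owner's call — this file only shows which tables and which weights the first-order words can be read on; 0 root-level binders of row D1 discharged (hW ∕ hR-sockets ∕ hSX-socket ∕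
D1Tel ∕ D1Rep = 0); (K) NOT closed; NOT D1, NOT `BetaPertH`, NOT continuum, NOT Clay.

ABSOLUTE RULE (cell charter, verbatim): «No internally-minted statement may enter as a cited fact. Every hypothesis is either kernel-proved in
this package or a verbatim quotation of a PUBLISHED theorem with page reference. The manuscript(s) under audit are NOT citable for their own
disputed steps — they are the thing under adjudication; programme-internal (2001/route/tribunal) claims are never citable.»

CONTENT (generic `d`; `r ∈ box (d+1) n` the road's root, the literal's centred root `ctr (d+1) n = toSite (ctrOff (d+1) n)`).
* §1 [folklore] **`vertexOfK_coProjSymAtK_coProjAtK_eq`** (ANY decaying `K`, ANY `LocStencil` family `S`, ONE in-block root for both slot dressings and both kernel dressings):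
  `vertexOfK K N (coProjSymAtK ρ N (coProjAtK ρ N S)) μ y = vertexOfK (coDressKAt ρ N (coDressKSymAt ρ N K)) N S μ y`.
* §2 [folklore] **`vertexOfK_G0bm_slotDress_eq_vertexOfK_GcombSh`**: at `K := G₀^{bm} r = coDressKBmAt (toSite r) n (KInvStep n 0)` and the centred slot dressings,
  `vertexOfK (G₀^{bm} r) n (coProjSymAtK ρc n (coProjAtK ρc n S)) μ y = vertexOfK (GcombSh n 0) n S μ y` (§1 + absorption + `GcombSh_apply ∕ Gsym_apply`).
* §3 [folklore] `coProjSymAtK_dressKAt_comm` (the outer SLOT window commutes with any inner LEG dressing of the stencil values) and **`vertexOfK_G0bm_dressedS_eq`** (the displayed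
  literal-level identity; `J⁰ : JetData d n` arbitrary — an2's `JsB12CombShSym = dressSymAt ρc (dressAt ρc (JsB12CombSh0 …))` is the instance of record).
* §4 [folklore, `d + 1 = 4`] **`vertexOfK_G0bm_JsB12CombShSym_S_eq`**: the instance of record, every level `j`, every in-block road root `r` (`JsB12CombShSym_eq` + §3).
NOT HERE (honest): the second-order (`W` ∕ `S₂`) twins (d1-formalise-leaf-03's «PACK-BRIDGE (III′)» PART 1∕2, the OWNER's S6′); any mass letter; the trace-word step (c2);
which side of each word carries the dressing in PART 23 (the OWNER's design); anything of Bałaban's.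
Unit `b2b-balaban-gan24-formalise-leaf-05` (gen 56), G-an2-4 swarm leaf prover 05, road «BF-x» supplier; OFFER W-2 (journal), INTENT to follow.  Not in print; our bookkeeping.
-/

noncomputable section

open Finset
open scoped BigOperators
open Literature.MathematicalPhysics.QuantumFieldTheory
open Literature.MathematicalPhysics.QuantumFieldTheory.Balaban1983to89
open Literature.MathematicalPhysics.QuantumFieldTheory.Balaban1983to89.Beta
open ExpKernelCalculus (MKer Decays)
open AffineAveraging (box toSite)
open AveragingContoursRooted (ctr ctrOff ctrOff_mem_box)
open RootedComb (ctr_eq_toSite)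
open OneStepResolventKernel (Fib wsum LocStencil)
open OneStepKernelFamily (colH vertexOfK KInvStep decays_KInvStep)
open Summit.QuantumFields.BalabanUV.Beta.TameKernelCalculus (Spr)
open Summit.QuantumFields.BalabanUV.Beta.AxialDressingRooted (one_le_of_neZero coDressKAt coDressKBmAt coProjAtK coProjW colH_coDressKAt_eq
  vertexOfK_coProjAtK locStencil_coProjAtK decays_coDressKBmAt_KInvStep cube dressKAt dressAt dressAt_S locStencil_dressKAt vertexOfK_dressKAt
  dressKAt_finset_sum dressKAt_mul_left)
open Summit.QuantumFields.BalabanUV.Beta.SymmetrisedDressingMatrix (pmSymBm)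
open Summit.QuantumFields.BalabanUV.Beta.SymmetrisedDressingKernel (coDressKSymAt decays_coDressKSymAt dressKSymAt)
open Summit.QuantumFields.BalabanUV.Beta.SymmetrisedDressingDress (coProjSymAtK dressSymAt dressSymAt_S locStencil_coProjSymAtK)
open Summit.QuantumFields.BalabanUV.Beta.SymmetrisedDressingLinear (coProjSymW colH_coDressKSymAt_eq vertexOfK_coProjSymAtK vertexOfK_dressKSymAt)
open Summit.QuantumFields.BalabanUV.Beta.SymmetrisedStepJets (Gsym Gsym_apply)
open Summit.QuantumFields.BalabanUV.Beta.SymmetrisedStepJets (SymTables)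
open Summit.QuantumFields.BalabanUV.Beta.CombChartStepJets (GcombSh GcombSh_apply JsB12CombSh0)
open Summit.QuantumFields.BalabanUV.Beta.CombChartJointEnd (JsB12CombShSym JsB12CombShSym_eq)
open Summit.QuantumFields.BalabanUV.Beta.D1BFx.SymBmAbsorbsBm (coDressKSymAt_coDressKBmAt)

namespace Summit.QuantumFields.BalabanUV.Beta.D1BFx.CombVertexAbsorption

variable {d : ℕ} {N : ℕ} {r : Fin (d + 1) → ℕ}

/-! ## §1 The composite slot dressing of the literal moves onto the packing column (an2's adjunctions, composed into ONE identity of kernels) -/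
/-- [folklore] **BOTH SLOT DRESSINGS OF THE (III′) LITERAL MOVE ONTO THE PACKING COLUMN AS THE COMB-CHART DRESSING** (an2's two windowed adjunctions
`vertexOfK_coProjSymAtK` ∕ `vertexOfK_coProjAtK` + `colH_coDressKSymAt_eq` ∕ `colH_coDressKAt_eq`, composed; the single-dressing forms are d1-formalise-leaf-03's
`PackedDressingBridgeComb.vertexOfK_coDressKAt_eq` ∕ `vertexOfK_coDressKSymAt_eq`):
`vertexOfK K N (Π̂ᵀ-slot (Πᵀ_ρ-slot S)) μ y = vertexOfK (Πᵀ_ρ (Π̂ᵀ K Π̂) Π_ρ) N S μ y` — so a vertex packed against `colH K` with slot-dressed tables is the vertex of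
the RAW tables packed against `colH (coDressKAt ρ N (coDressKSymAt ρ N K))` (whose envelope, for the one-shot `K` of the road, is «GCOMB-COL-ENV»). -/
theorem vertexOfK_coProjSymAtK_coProjAtK_eq (hN : 1 ≤ N) (hr : r ∈ box (d + 1) N) {K : MKer (d + 1) (Fib d)} {C δ : ℝ} (hC : 0 ≤ C)
    (hK : Decays K C δ) (hδK : 0 < δ) {S : Fin (d + 1) → (Fin (d + 1) → ℤ) → MKer (d + 1) (Fib d)} {Cs δs : ℝ} (hS : LocStencil S Cs δs)
    (hδs : 0 ≤ δs) (μ : Fin (d + 1)) (y : Fin (d + 1) → ℤ) :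
    vertexOfK K N (coProjSymAtK (toSite r) N (coProjAtK (toSite r) N S)) μ y
      = vertexOfK (coDressKAt (toSite r) N (coDressKSymAt (toSite r) N K)) N S μ y := by
  obtain ⟨δ', C', hδ', -, hK'⟩ := decays_coDressKSymAt hN hr (K := K) ⟨δ, C, hδK, hC, hK⟩
  -- outer (symmetrised) slot dressing onto the column: an2's `vertexOfK_coProjSymAtK` + `colH_coDressKSymAt_eq`
  have h1 : vertexOfK K N (coProjSymAtK (toSite r) N (coProjAtK (toSite r) N S)) μ y
      = vertexOfK (coDressKSymAt (toSite r) N K) N (coProjAtK (toSite r) N S) μ y := by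
    funext x z a b
    rw [vertexOfK_coProjSymAtK hN hr hK hδK (locStencil_coProjAtK hN hr hS hδs) hδs]
    show _ = ∑ κ' : Fin (d + 1), wsum (colH (coDressKSymAt (toSite r) N K) N μ y κ') (coProjAtK (toSite r) N S κ') x z a b
    rw [colH_coDressKSymAt_eq]
  -- inner (rooted comb) slot dressing onto the column: an2's `vertexOfK_coProjAtK` + `colH_coDressKAt_eq`
  have h2 : vertexOfK (coDressKSymAt (toSite r) N K) N (coProjAtK (toSite r) N S) μ y
      = vertexOfK (coDressKAt (toSite r) N (coDressKSymAt (toSite r) N K)) N S μ y := by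
    funext x z a b
    rw [vertexOfK_coProjAtK hN hr hK' hδ' hS hδs]
    show _ = ∑ κ' : Fin (d + 1), wsum (colH (coDressKAt (toSite r) N (coDressKSymAt (toSite r) N K)) N μ y κ') (S κ') x z a b
    rw [colH_coDressKAt_eq]
  rw [h1, h2]


/-! ## §2 The road's leg: the slot-dressed vertex against `G₀^{bm}` IS the comb-chart leg's vertex of the raw tables -/

/-- [folklore] **«COMB-VERTEX-ABSORPTION»**: for every in-block road root `r` and the literal's centred slot dressings,
`vertexOfK (G₀^{bm} r) n (Π̂ᵀ_{ρc}-slot (Πᵀ_{ρc}-slot S⁰)) μ y = vertexOfK (GcombSh n 0) n S⁰ μ y`, `G₀^{bm} r := coDressKBmAt (toSite r) n (KInvStep n 0)` —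
§1 at `K := G₀^{bm} r`, then d1-p2's absorption `coDressKSymAt ρc (G₀^{bm} r) = coDressKSymAt ρc (KInvStep n 0)` (ANY two roots) and an2's `GcombSh_apply ∕ Gsym_apply`.
The NEW packing weights are `colH (GcombSh n 0) n` — n-count «GCOMB-COL-ENV» (`D1BFx/CombColumnEnvelope`). -/
theorem vertexOfK_G0bm_slotDress_eq_vertexOfK_GcombSh {n : ℕ} [NeZero n] (hr : r ∈ box (d + 1) n)
    {S : Fin (d + 1) → (Fin (d + 1) → ℤ) → MKer (d + 1) (Fib d)} {Cs δs : ℝ} (hS : LocStencil S Cs δs) (hδs : 0 ≤ δs)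
    (μ : Fin (d + 1)) (y : Fin (d + 1) → ℤ) :
    vertexOfK (coDressKBmAt (toSite r) n (KInvStep (d := d) n 0)) n
        (coProjSymAtK (ctr (d + 1) n) n (coProjAtK (ctr (d + 1) n) n S)) μ y
      = vertexOfK (GcombSh (d := d) n 0) n S μ y := by
  have hn : 1 ≤ n := one_le_of_neZero n
  have hc : ctrOff (d + 1) n ∈ box (d + 1) n := ctrOff_mem_box hn
  obtain ⟨δ, C, hδ, hC, hK⟩ := decays_coDressKBmAt_KInvStep (d := d) hr 0
  have hspr : Spr (KInvStep (d := d) n 0) := by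
    obtain ⟨δ₀, C₀, hδ₀, -, h₀⟩ := decays_KInvStep (d := d) (Lc := n) 0
    exact ⟨C₀, δ₀, hδ₀, h₀⟩
  rw [ctr_eq_toSite, vertexOfK_coProjSymAtK_coProjAtK_eq hn hc hC hK hδ hS hδs, coDressKSymAt_coDressKBmAt hn hr hc hspr,
    GcombSh_apply, Gsym_apply, ctr_eq_toSite]


/-! ## §3 … with the LEG dressings: the road's vertex OF THE DRESSED LITERAL TABLES is the doubly LEG-dressed comb vertex of the RAW tables -/

/-- [folklore] The symmetrised SLOT dressing commutes with any rooted LEG dressing of the stencil values (the slot window is a finite linear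
combination of slots; the leg dressing is linear in the kernel — an2's `dressKAt_finset_sum` ∕ `dressKAt_mul_left`). -/
theorem coProjSymAtK_dressKAt_comm (ρ ρ' : Fin (d + 1) → ℤ) (N N' : ℕ) (F : Fin (d + 1) → (Fin (d + 1) → ℤ) → MKer (d + 1) (Fib d)) :
    coProjSymAtK ρ N (fun κ u => dressKAt ρ' N' (F κ u)) = fun κ u => dressKAt ρ' N' (coProjSymAtK ρ N F κ u) := by
  funext κ u x y a b
  show ∑ v ∈ cube (d + 1) N, ∑ β : Fin (d + 1), pmSymBm ρ N β (u + v) κ u * dressKAt ρ' N' (F β (u + v)) x y a b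
    = dressKAt ρ' N' (fun x y a b => ∑ v ∈ cube (d + 1) N, (fun v => fun x y a b => ∑ β : Fin (d + 1), pmSymBm ρ N β (u + v) κ u * F β (u + v) x y a b) v x y a b)
        x y a b
  rw [dressKAt_finset_sum]
  refine Finset.sum_congr rfl fun v _ => ?_
  rw [show (fun x y a b => ∑ β : Fin (d + 1), pmSymBm ρ N β (u + v) κ u * F β (u + v) x y a b)
      = fun x y a b => ∑ β : Fin (d + 1), (fun β => fun x y a b => pmSymBm ρ N β (u + v) κ u * F β (u + v) x y a b) β x y a b from rfl,
    dressKAt_finset_sum]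
  refine Finset.sum_congr rfl fun β _ => ?_
  exact (dressKAt_mul_left ρ' N' _ _ x y a b).symm

/-- [folklore] **«COMB-VERTEX-ABSORPTION» AT THE DRESSED LITERAL**: for ANY raw datum `J⁰ : JetData d n`, every in-block road root `r`, and the literal's
centred dressings `dressSymAt ∘ dressAt` (an2's `JsB12CombShSym = dressSymAt ρc (dressAt ρc JsB12CombSh0)` is the instance):
`vertexOfK (G₀^{bm} r) n (dressSymAt hc (dressAt hc J⁰)).S μ y = dressKSymAt ρc n (dressKAt ρc n (vertexOfK (GcombSh n 0) n J⁰.S μ y))` —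
the road's packed first-order vertex at the DRESSED literal tables is the doubly LEG-dressed comb-chart vertex of the RAW tables, packed against
`colH (GcombSh n 0) n` (§2; leg dressings out by an2's `vertexOfK_dressKSymAt` ∕ `vertexOfK_dressKAt`).  The per-slot n-powers of the dressed tables
never enter: the RAW tables' letters and the weights' envelope «GCOMB-COL-ENV» do. -/
theorem vertexOfK_G0bm_dressedS_eq {n : ℕ} [NeZero n] (hr : r ∈ box (d + 1) n) (J : OneStepResolventKernel.JetData d n) (μ : Fin (d + 1))
    (y : Fin (d + 1) → ℤ) :
    vertexOfK (coDressKBmAt (toSite r) n (KInvStep (d := d) n 0)) n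
        (dressSymAt (ctrOff_mem_box (d := d + 1) (one_le_of_neZero n)) (dressAt (ctrOff_mem_box (d := d + 1) (one_le_of_neZero n)) J)).S μ y
      = dressKSymAt (ctr (d + 1) n) n (dressKAt (ctr (d + 1) n) n (vertexOfK (GcombSh (d := d) n 0) n J.S μ y)) := by
  have hn : 1 ≤ n := one_le_of_neZero n
  have hc : ctrOff (d + 1) n ∈ box (d + 1) n := ctrOff_mem_box hn
  obtain ⟨δ, C, hδ, -, hK⟩ := decays_coDressKBmAt_KInvStep (d := d) hr 0
  -- the literal's `.S`: outer sym (leg ∘ slot) of inner ax (leg ∘ slot); commute the inner LEG dressing past the outer SLOT dressing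
  have hS : (dressSymAt hc (dressAt hc J)).S
      = fun κ u => dressKSymAt (ctr (d + 1) n) n (dressKAt (ctr (d + 1) n) n
          (coProjSymAtK (ctr (d + 1) n) n (coProjAtK (ctr (d + 1) n) n J.S) κ u)) := by
    funext κ u
    rw [dressSymAt_S, show (dressAt hc J).S = fun κ u => dressKAt (toSite (ctrOff (d + 1) n)) n (coProjAtK (toSite (ctrOff (d + 1) n)) n J.S κ u)
      from rfl, coProjSymAtK_dressKAt_comm]
    rfl
  -- localisation letters of the inner families (an2's, qualitative)
  have h1 : LocStencil (coProjAtK (ctr (d + 1) n) n J.S) _ J.δ := locStencil_coProjAtK hn hc J.loc J.δ_pos.le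
  have h2 : LocStencil (coProjSymAtK (ctr (d + 1) n) n (coProjAtK (ctr (d + 1) n) n J.S)) _ J.δ := locStencil_coProjSymAtK hn hc h1 J.δ_pos.le
  have h3 : LocStencil (fun κ u => dressKAt (ctr (d + 1) n) n (coProjSymAtK (ctr (d + 1) n) n (coProjAtK (ctr (d + 1) n) n J.S) κ u)) _ J.δ :=
    locStencil_dressKAt hn hc h2 J.δ_pos.le
  rw [hS, vertexOfK_dressKSymAt (ctr (d + 1) n) n hK hδ.le h3 J.δ_pos, vertexOfK_dressKAt (ctr (d + 1) n) n hK hδ.le h2 J.δ_pos,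
    vertexOfK_G0bm_slotDress_eq_vertexOfK_GcombSh hr J.loc J.δ_pos.le]


/-! ## §4 `d + 1 = 4`: the instance of record — an2's chart-(III′) literal `JsB12CombShSym = dressSymAt ρc (dressAt ρc JsB12CombSh⁰)` -/

/-- [folklore] **THE ROAD's VERTEX OF THE (III′) LITERAL's DRESSED TABLES, EVERY LEVEL `j`, EVERY IN-BLOCK ROAD ROOT `r`:**
`vertexOfK (G₀^{bm} r) n (JsB12CombShSym hodd N tabs cΛ cB j).S μ y = dressKSymAt ρc n (dressKAt ρc n (vertexOfK (GcombSh n 0) n (JsB12CombSh0 hodd N tabs cΛ cB j).S μ y))`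
(§3 + `CombChartJointEnd.JsB12CombShSym_eq`, `rfl`-unfolding; at `j = 0` and blocking `n = Lc^m` this is the `S`-slot of `JcOf` ∕ `JcOfTabs`). -/
theorem vertexOfK_G0bm_JsB12CombShSym_S_eq {n : ℕ} [NeZero n] (hodd : Odd n) (N : ℕ) (tabs : SymTables 3 n) (cΛ cB : ℝ) (j : ℕ)
    {r : Fin (3 + 1) → ℕ} (hr : r ∈ box (3 + 1) n) (μ : Fin (3 + 1)) (y : Fin (3 + 1) → ℤ) :
    vertexOfK (coDressKBmAt (toSite r) n (KInvStep (d := 3) n 0)) n (JsB12CombShSym hodd N tabs cΛ cB j).S μ y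
      = dressKSymAt (ctr (3 + 1) n) n (dressKAt (ctr (3 + 1) n) n (vertexOfK (GcombSh (d := 3) n 0) n (JsB12CombSh0 hodd N tabs cΛ cB j).S μ y)) := by
  rw [JsB12CombShSym_eq]
  exact vertexOfK_G0bm_dressedS_eq hr (JsB12CombSh0 hodd N tabs cΛ cB j) μ y

end Summit.QuantumFields.BalabanUV.Beta.D1BFx.CombVertexAbsorption

end
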